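import Literature.AlgebraicGeometry.HodgeTheory.PicardLefschetzNodalForms
import Literature.AlgebraicGeometry.HodgeTheory.SymmetricHypersurfaceInvolution

/-!
# K1-B nodal forms (route `SignSymmetricPowers`, item stmt-HodgeConjecture-19716) — shared tools

Helper file for the registered stub `stub_signNodalForms` (K1-B line `andre-zariski` v9/v10, WANTED
P3-W8): explicit ι-even nodal quinary forms of every even degree `d ≥ 4` with prescribed nodes. This
file holds the form-independent tools; landed `--supports stmt-HodgeConjecture-19716` as a helper.
Sorry-free; axioms standard. THEOREMS only.

* `coeff_eq_zero_of_sign_aeval_eq` — a quinary form FIXED by the sign substitution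
  `ι : (x₀, x₁, x₂, x₃, x₄) ↦ (-x₀, -x₁, x₂, x₃, x₄)` (`aeval (diagSubst (signVector ℂ 2))`) has no monomial
  of odd degree in `x₀, x₁` (the route's "ι-even" hypothesis) — by `coeff_aeval_diagSubst`:
  `coeff e (ι f) = (-1)^{e₀+e₁} coeff e f`.
* `rank_eq_four` — a `5 × 5` complex matrix with a non-zero kernel vector and a two-sided multiple
  `A M B = diagonal w`, `w` vanishing at exactly one index, has rank `4` (rank–nullity + `rank_diagonal`).
* `split_pair_eq_zero` — the ALGEBRAIC heart of the uniqueness of the node for the split witnesses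
  `w (x_a x_b + y_a y_b) + α₁ x_a^d + α₂ x_b^d + β₁ y_a^d + β₂ y_b^d`: the critical equations
  `w x_b + d α₁ x_a^{d-1} = 0`, `w x_a + d α₂ x_b^{d-1} = 0`, `w y_b + d β₁ y_a^{d-1} = 0`,
  `w y_a + d β₂ y_b^{d-1} = 0`, `x_a x_b + y_a y_b = 0` with `w ≠ 0`, `d ≠ 0`, `d - 1` odd and
  `α₁ α₂ ≠ β₁ β₂` force `x_a = x_b = y_a = y_b = 0` (multiply the equations pairwise:
  `d² α₁α₂ P^{d-1} = w² P`, `d² β₁β₂ Q^{d-1} = w² Q` for `P = x_a x_b = -Q`, so `(α₁α₂ - β₁β₂) P^{d-1} = 0`).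
* `eq_smul_of_apply_eq` — a vector with four prescribed zero coordinates is a multiple of the
  remaining basis vector (bookkeeping for `∃ t, z = t • p`).
-/

set_option linter.dupNamespace false

noncomputable section

namespace Summit.HodgeConjecture.HodgeConjecture.Theorems.SignSymmetricPowersNodalFormsTools

open MvPolynomial Literature.AlgebraicGeometry.Motives Literature.AlgebraicGeometry.HodgeTheory

/-- `ι xⱼ = (± 1) xⱼ` for the sign substitution `ι = aeval (diagSubst (signVector ℂ 2))`. -/
theorem sign_aeval_X (j : Fin 5) :
    aeval (ProjectiveSpace.diagSubst (signVector ℂ 2 : Fin 5 → ℂ)) (X j : MvPolynomial (Fin 5) ℂ) =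
      C (if (j : ℕ) < 2 then (-1 : ℂ) else 1) * X j := by
  rw [aeval_X, ProjectiveSpace.diagSubst_apply, signVector_apply]

/-- **ι-invariance ⇒ ι-even**: a quinary form fixed by `(x₀, x₁) ↦ (-x₀, -x₁)` has no monomial of odd
degree in `x₀, x₁`. -/
theorem coeff_eq_zero_of_sign_aeval_eq (f : MvPolynomial (Fin 5) ℂ)
    (hf : aeval (ProjectiveSpace.diagSubst (signVector ℂ 2 : Fin 5 → ℂ)) f = f)
    (e : Fin 5 →₀ ℕ) (he : ¬ Even (e 0 + e 1)) : f.coeff e = 0 := by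
  have h := coeff_aeval_diagSubst (signVector ℂ 2 : Fin 5 → ℂ) f e
  rw [hf, prod_signVector_pow] at h
  have hs : (∑ j ∈ Finset.univ.filter (fun j : Fin (4 + 1) ↦ (j : ℕ) < 2), e j) = e 0 + e 1 := by
    have hset : Finset.univ.filter (fun j : Fin (4 + 1) ↦ (j : ℕ) < 2) = {0, 1} := by decide
    rw [hset, Finset.sum_pair (by decide)]
  rw [hs, (Nat.not_even_iff_odd.1 he).neg_one_pow, neg_one_mul, eq_neg_iff_add_eq_zero, ← two_mul] at h
  exact (mul_eq_zero.1 h).resolve_left two_ne_zero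

/-- **Rank `4` of a `5 × 5` matrix** from a non-zero kernel vector and a two-sided multiple equal to a
diagonal matrix whose diagonal vanishes at exactly one index. -/
theorem rank_eq_four {M A B : Matrix (Fin 5) (Fin 5) ℂ} {v : Fin 5 → ℂ} (hv : v ≠ 0)
    (hMv : M.mulVec v = 0) {w : Fin 5 → ℂ} (hw : A * M * B = Matrix.diagonal w) (k : Fin 5)
    (hk : ∀ i, w i = 0 ↔ i = k) : M.rank = 4 := by
  classical
  apply le_antisymm
  · have h1 := LinearMap.finrank_range_add_finrank_ker M.mulVecLin
    rw [Module.finrank_fintype_fun_eq_card, Fintype.card_fin] at h1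
    have hker : 1 ≤ Module.finrank ℂ (LinearMap.ker M.mulVecLin) := by
      rw [Nat.one_le_iff_ne_zero]
      intro h0
      rw [Submodule.finrank_eq_zero] at h0
      have : v ∈ LinearMap.ker M.mulVecLin := by
        rw [LinearMap.mem_ker, Matrix.mulVecLin_apply, hMv]
      rw [h0, Submodule.mem_bot] at this
      exact hv this
    change Module.finrank ℂ (LinearMap.range M.mulVecLin) ≤ 4
    omega
  · have hcard : Fintype.card {i // w i ≠ 0} = 4 := by
      rw [Fintype.card_subtype]
      have hset : Finset.univ.filter (fun i : Fin 5 ↦ w i ≠ 0) = Finset.univ.erase k := by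
        ext i
        simp only [Finset.mem_filter, Finset.mem_univ, true_and, Finset.mem_erase, ne_eq, hk, and_true]
      rw [hset, Finset.card_erase_of_mem (Finset.mem_univ k), Finset.card_univ, Fintype.card_fin]
    calc 4 = (Matrix.diagonal w).rank := by rw [Matrix.rank_diagonal, hcard]
      _ = (A * M * B).rank := by rw [hw]
      _ ≤ (A * M).rank := Matrix.rank_mul_le_left _ _
      _ ≤ M.rank := Matrix.rank_mul_le_right _ _

/-- **The algebraic heart of the uniqueness of the node** for the split witnesses: the critical
equations of `w (x_a x_b + y_a y_b) + α₁ x_a^d + α₂ x_b^d + β₁ y_a^d + β₂ y_b^d` off the node force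
`x_a = x_b = y_a = y_b = 0` when `α₁ α₂ ≠ β₁ β₂` (`n = d - 1` odd, `w, d ≠ 0`). -/
theorem split_pair_eq_zero {K : Type*} [Field K] {w d α₁ α₂ β₁ β₂ xa xb ya yb : K} {n : ℕ}
    (hn : Odd n) (hw : w ≠ 0) (hd : d ≠ 0) (hαβ : α₁ * α₂ ≠ β₁ * β₂)
    (h1 : w * xb + d * α₁ * xa ^ n = 0) (h2 : w * xa + d * α₂ * xb ^ n = 0)
    (h3 : w * yb + d * β₁ * ya ^ n = 0) (h4 : w * ya + d * β₂ * yb ^ n = 0)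
    (hs : xa * xb + ya * yb = 0) : xa = 0 ∧ xb = 0 ∧ ya = 0 ∧ yb = 0 := by
  have hn0 : n ≠ 0 := by rintro rfl; exact Nat.not_odd_zero hn
  -- `d² α₁α₂ P^n = w² P` and `d² β₁β₂ Q^n = w² Q`
  have eP : d ^ 2 * (α₁ * α₂) * (xa * xb) ^ n = w ^ 2 * (xa * xb) := by
    have e1 : d * α₁ * xa ^ n = -(w * xb) := eq_neg_of_add_eq_zero_right h1
    have e2 : d * α₂ * xb ^ n = -(w * xa) := eq_neg_of_add_eq_zero_right h2
    calc d ^ 2 * (α₁ * α₂) * (xa * xb) ^ n = (d * α₁ * xa ^ n) * (d * α₂ * xb ^ n) := by ring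
      _ = w ^ 2 * (xa * xb) := by rw [e1, e2]; ring
  have eQ : d ^ 2 * (β₁ * β₂) * (ya * yb) ^ n = w ^ 2 * (ya * yb) := by
    have e3 : d * β₁ * ya ^ n = -(w * yb) := eq_neg_of_add_eq_zero_right h3
    have e4 : d * β₂ * yb ^ n = -(w * ya) := eq_neg_of_add_eq_zero_right h4
    calc d ^ 2 * (β₁ * β₂) * (ya * yb) ^ n = (d * β₁ * ya ^ n) * (d * β₂ * yb ^ n) := by ring
      _ = w ^ 2 * (ya * yb) := by rw [e3, e4]; ring
  have hQ : ya * yb = -(xa * xb) := eq_neg_of_add_eq_zero_right hs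
  rw [hQ, hn.neg_pow, mul_neg, mul_neg, neg_inj] at eQ
  -- hence `P = 0`
  have hP : xa * xb = 0 := by
    have h : d ^ 2 * (α₁ * α₂ - β₁ * β₂) * (xa * xb) ^ n = 0 := by
      rw [mul_sub, sub_mul, eP, eQ, sub_self]
    rcases mul_eq_zero.1 h with h | h
    · rcases mul_eq_zero.1 h with h | h
      · exact absurd (pow_eq_zero_iff two_ne_zero |>.1 h) hd
      · exact absurd (sub_eq_zero.1 h) hαβ
    · exact (pow_eq_zero_iff hn0).1 h
  have hQ0 : ya * yb = 0 := by rw [hQ, hP, neg_zero]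
  have zpow : (0 : K) ^ n = 0 := zero_pow hn0
  refine ⟨?_, ?_, ?_, ?_⟩
  · rcases mul_eq_zero.1 hP with h | h
    · exact h
    · rw [h, zpow, mul_zero, add_zero] at h2; exact (mul_eq_zero.1 h2).resolve_left hw
  · rcases mul_eq_zero.1 hP with h | h
    · rw [h, zpow, mul_zero, add_zero] at h1; exact (mul_eq_zero.1 h1).resolve_left hw
    · exact h
  · rcases mul_eq_zero.1 hQ0 with h | h
    · exact h
    · rw [h, zpow, mul_zero, add_zero] at h4; exact (mul_eq_zero.1 h4).resolve_left hw
  · rcases mul_eq_zero.1 hQ0 with h | h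
    · rw [h, zpow, mul_zero, add_zero] at h3; exact (mul_eq_zero.1 h3).resolve_left hw
    · exact h

/-- A vector `z : Fin 5 → ℂ` is `t • p` as soon as all its coordinates agree with those of `t • p`
(bookkeeping for the conclusion `∃ t, z = t • p` of `IsNodalFormWithNodes`). -/
theorem eq_smul_of_apply_eq {z p : Fin 5 → ℂ} {t : ℂ} (h0 : z 0 = t * p 0) (h1 : z 1 = t * p 1)
    (h2 : z 2 = t * p 2) (h3 : z 3 = t * p 3) (h4 : z 4 = t * p 4) : z = t • p := by
  funext i
  fin_cases i
  · simpa using h0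
  · simpa using h1
  · simpa using h2
  · simpa using h3
  · simpa using h4

end Summit.HodgeConjecture.HodgeConjecture.Theorems.SignSymmetricPowersNodalFormsTools

end
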